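import Summits.QuantumFields.YangMills.Theorems.BalabanUVNodesN11KernelTransportRecoordinatisation
import Summits.QuantumFields.YangMills.Theorems.BalabanUVNodesN11KernelTransportSkewInnerChart
import Literature.MathematicalPhysics.QuantumFieldTheory.Balaban1983to89.Node00.AveragingSkewPresentation

/-!
# DAG node N11 — THE SEPARATED TRANSPORT READ THROUGH A PRODUCT PRESENTATION, INNER FIBRE CHARTED (generic capstone of the (B4) abstract layer)

HEADER — WORK-UNIT METADATA.  Cell `pub-ymgap`, YM-PLAN Track A (HUMAN RULING D-0062 ∕ D-0149), WIDTH SEAT `pub-ymgap-dag-n11-w2` (g3) on node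
N11 [B14]; route `BalabanUVNodes`, key item K1⁷ `StabilityBAtRecordR13SepCoPH` = stmt-QuantumFields-20542 (helper, `--kind proof --supports 20542
--as helper`, count-neutral).  [I] = [Balaban1987RG1], [III] = [Balaban1988Convergent].  Sequel of this seat's FILE 1 `…N11KernelTransportSkewProduct`
(p611138) and FILE 2 `…N11KernelTransportRecoordinatisation` (p612351), composed with dag-n11-d's charted-inner endpoint `…N11KernelTransportSkewInnerChart`
(p612397).

WHY.  The (B4) abstract layer in the tree reads: socket (dag-n11-d p610288) → skew-product chain rule on PRODUCT carriers (FILE 1) → charted-inner endpoint on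
PRODUCT carriers (dag-n11-d p612397) → naturality under PRESENTATIONS of one-carrier transports by products (FILE 2).  THIS FILE closes the square: a
ONE-CARRIER transport (`ν` on `β`, `μ` on `α`, `avg : β → α` — at the record def-T's `transportOfRecord k = kernelTransport (fieldMeasure k) (fieldMeasure (k+1))
avOfRecord`) PRESENTED by products (`e_β : B × D → β` pushing `ν_out ⊗ ν_in` to `ν` — at the record the bond-partition glue of dag-n11-e's
`Node00/AveragingSkewPresentation`; `e_α : A × R ≃ᵐ α` likewise) with the SKEW intertwining `avg (e_β U) = e_α (avg_out U.1, avg_rest U)` and the inner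
fibre CHARTED (dag-n11-d's socket on the product side) IS, in the product coordinates of the coarse carrier, «outside variables by the true un-charted
transport `kernelTransport ν_out μ_out avg_out` (at the record 11a's `kernelRTOfRecord`), inside variables of the operand read at the chart point».

WHAT THIS FILE PROVES (generic measurable spaces; standard Borel ∕ finiteness side conditions as displayed; 0 `def`, 0 `sorry`).
* §1 ★★★ `kernelTransport_recoord_skew_ae_eq_of_innerChart` — FILE 2 §1 `kernelTransport_recoord_ae_eq` ∘ dag-n11-d's `kernelTransport_skew_ae_eq_of_innerChart`:
  `(kernelTransport ν μ avg ρ) ∘ e_α =ᵐ[μ_out ⊗ μ_r] (V_out, r) ↦ kernelTransport ν_out μ_out avg_out [u ↦ ∫ J((u,r),x) · ρ (e_β (u, Ψ ((u,r),x))) ∂κ(u,r)] V_out`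
  for every measurable `ν`-integrable `ρ` whose presented density vanishes off the charted set `S`;
  `kernelTransport_recoord_skew_ae_eq_of_innerChart_of_preimage` — the same with the charted set presented as a pull-back `e_β ⁻¹' S₀` and `ρ` vanishing off `S₀`.
* §2 AT THE RECORD (`G = SU(N)`, step `k < K` of the `K`-th torus, a fine region `Y` saturated at level `k+1`, finsets `sV ∕ sV'` representing its bond sets,
  carriers presented by dag-n11-e's bond-partition glue — p612977 supplies the presentations, the skew intertwining with out-factor `avgRestrOfRecord`, and both
  a.c. binders; def-T's `avOfRecord_haarAC` the third): ★★★★ `transportOfRecord_comp_glue_ae_eq_kernelRTOfRecord` (inner reading displayed) and its `_bondsIn`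
  edition at 11a's exact bond sets; ★★★★ `transportOfRecord_comp_glue_ae_eq_kernelRTOfRecord_of_innerChart` (inner fibre charted by dag-n11-d's socket):
  `(transportOfRecord F N K k ρ) ∘ eα =ᵐ (V_out, r) ↦ kernelRTOfRecord F N K k sV sV' [inner reading (·, r)] V_out` — def-T's ONE-STEP TRANSPORT OF RECORD, read
  through the presentation, IS 11a's `kernelRTOfRecord` on the out-bonds applied to the inner reading; only `hY` and `hin` (resp. the chart) stay displayed.

NOT IN THIS FILE: the saturation `hY` at def-R's regions of record (dag-n11-e's INTENT-2), the inner chart ∕ Jacobian at the record ((B4) concrete half: a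
Lie–Haar chart seat), the (O3′)-side junction with 11a's `genOp = vOp ∘ zetaOp ∘ aOp` ∕ def-T's (†) (`tkBranchOfRecord_succ`), K0b's re-pin of `quad ∕ ζ`.

HONEST FRAMING.  Helper lane of K1⁷, count-neutral; a composition of landed [folklore] measure theory over def-T's DEFINITIONS; nothing of Bałaban's
asserted; (B4) ∕ (S-α) NOT closed; no registered stub proved; N11 NOT discharged; K1⁷ NOT closed; counts unmoved (typed 28∕28 · discharged 5∕27).  One finite
four-torus programme at fixed `ε = L^{−K}`; R4 closes only the conditional finite-𝕋⁴ rung `BalabanLadder.UV` — NOT ℝ⁴, NOT OS, NOT a mass gap, NOT Clay.  No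
`sorry`, `axiom`, `def`, `instance`, `notation`.  Sources (SHAPE only): [III] (2.20)–(2.21) p.258, (3.1) p.264, pp.267–270; [I] (0.4) p.253, §2 p.267.
-/

noncomputable section

open MeasureTheory ProbabilityTheory Set Filter
open scoped ENNReal NNReal

namespace Summit.QuantumFields.YangMills.Theorems.BalabanUVNodesN11TransportOfRecordSeparated

open Literature.MathematicalPhysics.QuantumFieldTheory.Balaban1983to89
open T4AveragingDisintegration (kernelTransport)
open BalabanUVNodesN11KernelTransportRecoordinatisation (kernelTransport_recoord_ae_eq integrable_comp_of_map_eq)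
open BalabanUVNodesN11KernelTransportSkewInnerChart (kernelTransport_skew_ae_eq_of_innerChart)

/-! ## §1  One-carrier transport, product presentation, charted inner fibre -/

section Generic

variable {α β A B D R X : Type*} [MeasurableSpace α] [MeasurableSpace β] [MeasurableSpace A] [MeasurableSpace B] [MeasurableSpace D]
  [MeasurableSpace R] [MeasurableSpace X]
  [StandardBorelSpace β] [Nonempty β] [StandardBorelSpace B] [Nonempty B] [StandardBorelSpace D] [Nonempty D]
  [StandardBorelSpace R] [Nonempty R]

/-- ★★★ **THE SEPARATED TRANSPORT THROUGH A PRODUCT PRESENTATION, INNER FIBRE CHARTED.**  A one-carrier step `(ν, μ, avg)` with `ν.map avg ≪ μ`, presented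
by `e_β : B × D → β` (`(ν_out ⊗ ν_in).map e_β = ν`) and `e_α : A × R ≃ᵐ α` (`(μ_out ⊗ μ_r).map e_α = μ`) with the skew intertwining
`avg (e_β U) = e_α (avg_out U.1, avg_rest U)`; the outside step `ν_out.map avg_out ≪ μ_out`; the inner step `U ↦ (U.1, avg_rest U)` absolutely continuous onto
`ν_out ⊗ μ_r` and CHARTED there by dag-n11-d's socket (`κ`-fibres, inside configuration `Ψ ((u, r), x)`, Jacobian `J`, charted set `S`: `hpush`, `hfib`); `ρ`
measurable, `ν`-integrable, its presented density vanishing off `S`.  THEN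
`(kernelTransport ν μ avg ρ) ∘ e_α =ᵐ[μ_out ⊗ μ_r] (V_out, r) ↦ kernelTransport ν_out μ_out avg_out [u ↦ ∫ J((u,r),x) · ρ (e_β (u, Ψ ((u,r),x))) ∂κ(u,r)] V_out`. -/
theorem kernelTransport_recoord_skew_ae_eq_of_innerChart
    (ν : Measure β) [IsFiniteMeasure ν] (μ : Measure α) [SigmaFinite μ]
    (ν_out : Measure B) [IsFiniteMeasure ν_out] (ν_in : Measure D) [IsFiniteMeasure ν_in]
    (μ_out : Measure A) [SigmaFinite μ_out] (μ_r : Measure R) [IsFiniteMeasure μ_r]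
    {e_β : B × D → β} (he_β : Measurable e_β) (hν : (ν_out.prod ν_in).map e_β = ν)
    (e_α : A × R ≃ᵐ α) (hμ : (μ_out.prod μ_r).map e_α = μ)
    {avg : β → α} (havg : Measurable avg) {avg_out : B → A} (havg_out : Measurable avg_out)
    {avg_rest : B × D → R} (havg_rest : Measurable avg_rest)
    (hint : ∀ U, avg (e_β U) = e_α (avg_out U.1, avg_rest U)) (hac : ν.map avg ≪ μ)
    (hac_out : ν_out.map avg_out ≪ μ_out)
    (hac_in : (ν_out.prod ν_in).map (fun U => (U.1, avg_rest U)) ≪ ν_out.prod μ_r)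
    {κ : Kernel (B × R) X} [IsSFiniteKernel κ] {Ψ : (B × R) × X → D} (hΨ : Measurable Ψ) {J : (B × R) × X → ℝ≥0} (hJ : Measurable J)
    {S : Set (B × D)}
    (hpush : (((ν_out.prod μ_r) ⊗ₘ κ).withDensity (fun z => (J z : ℝ≥0∞))).map (fun z => ((z.1.1, Ψ z) : B × D))
      = (ν_out.prod ν_in).restrict S)
    (hfib : ∀ᵐ z ∂(((ν_out.prod μ_r) ⊗ₘ κ).withDensity (fun z => (J z : ℝ≥0∞))), avg_rest (z.1.1, Ψ z) = z.1.2)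
    {ρ : β → ℝ} (hρm : Measurable ρ) (hρ : Integrable ρ ν) (hρS : ∀ q, q ∉ S → ρ (e_β q) = 0) :
    (kernelTransport ν μ avg ρ) ∘ e_α
      =ᵐ[μ_out.prod μ_r] fun v => kernelTransport ν_out μ_out avg_out
        (fun u => ∫ x, (J ((u, v.2), x) : ℝ) * ρ (e_β (u, Ψ ((u, v.2), x))) ∂(κ (u, v.2))) v.1 := by
  have havg' : Measurable (fun U : B × D => (avg_out U.1, avg_rest U)) := (havg_out.comp measurable_fst).prodMk havg_rest
  have hρ' : Integrable (ρ ∘ e_β) (ν_out.prod ν_in) := integrable_comp_of_map_eq _ he_β hν hρ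
  have h1 := kernelTransport_recoord_ae_eq ν (ν_out.prod ν_in) μ (μ_out.prod μ_r) he_β hν e_α hμ havg havg' hint hac hρ
  have h2 := kernelTransport_skew_ae_eq_of_innerChart ν_out ν_in μ_out μ_r havg_out hac_out havg_rest hac_in hΨ hJ hpush hfib
    (hρm.comp he_β) hρ' (fun q hq => hρS q hq)
  exact h1.trans h2

/-- The same with the charted set PRESENTED as a pull-back: `S := e_β ⁻¹' S₀` for a set `S₀ ⊆ β` off which `ρ` itself vanishes (the natural shape when the
small-field window is a subset of the one-carrier configuration space). -/
theorem kernelTransport_recoord_skew_ae_eq_of_innerChart_of_preimage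
    (ν : Measure β) [IsFiniteMeasure ν] (μ : Measure α) [SigmaFinite μ]
    (ν_out : Measure B) [IsFiniteMeasure ν_out] (ν_in : Measure D) [IsFiniteMeasure ν_in]
    (μ_out : Measure A) [SigmaFinite μ_out] (μ_r : Measure R) [IsFiniteMeasure μ_r]
    {e_β : B × D → β} (he_β : Measurable e_β) (hν : (ν_out.prod ν_in).map e_β = ν)
    (e_α : A × R ≃ᵐ α) (hμ : (μ_out.prod μ_r).map e_α = μ)
    {avg : β → α} (havg : Measurable avg) {avg_out : B → A} (havg_out : Measurable avg_out)
    {avg_rest : B × D → R} (havg_rest : Measurable avg_rest)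
    (hint : ∀ U, avg (e_β U) = e_α (avg_out U.1, avg_rest U)) (hac : ν.map avg ≪ μ)
    (hac_out : ν_out.map avg_out ≪ μ_out)
    (hac_in : (ν_out.prod ν_in).map (fun U => (U.1, avg_rest U)) ≪ ν_out.prod μ_r)
    {κ : Kernel (B × R) X} [IsSFiniteKernel κ] {Ψ : (B × R) × X → D} (hΨ : Measurable Ψ) {J : (B × R) × X → ℝ≥0} (hJ : Measurable J)
    {S₀ : Set β}
    (hpush : (((ν_out.prod μ_r) ⊗ₘ κ).withDensity (fun z => (J z : ℝ≥0∞))).map (fun z => ((z.1.1, Ψ z) : B × D))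
      = (ν_out.prod ν_in).restrict (e_β ⁻¹' S₀))
    (hfib : ∀ᵐ z ∂(((ν_out.prod μ_r) ⊗ₘ κ).withDensity (fun z => (J z : ℝ≥0∞))), avg_rest (z.1.1, Ψ z) = z.1.2)
    {ρ : β → ℝ} (hρm : Measurable ρ) (hρ : Integrable ρ ν) (hρS : ∀ U, U ∉ S₀ → ρ U = 0) :
    (kernelTransport ν μ avg ρ) ∘ e_α
      =ᵐ[μ_out.prod μ_r] fun v => kernelTransport ν_out μ_out avg_out
        (fun u => ∫ x, (J ((u, v.2), x) : ℝ) * ρ (e_β (u, Ψ ((u, v.2), x))) ∂(κ (u, v.2))) v.1 :=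
  kernelTransport_recoord_skew_ae_eq_of_innerChart ν μ ν_out ν_in μ_out μ_r he_β hν e_α hμ havg havg_out havg_rest hint hac hac_out hac_in
    hΨ hJ hpush hfib hρm hρ (fun q hq => hρS (e_β q) hq)

end Generic

/-! ## §2  AT THE RECORD: def-T's one-step transport of record through dag-n11-e's bond-partition presentation IS 11a's `kernelRTOfRecord`
applied to the inner reading -/

section Record

open T4Continuum Node00
open B10Eq42TorusConstraint (bondsIn)
open B10Eq38TorusDomains (toFine)
open BalabanUVNodesN11KernelTransportRecoordinatisation (kernelTransport_skewProduct_recoord_ae_eq)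

variable (F : T4Family) (N : ℕ) [NeZero N]

/-- ★★★★ **THE SEPARATED TRANSPORT OF RECORD (inner reading displayed).**  At step `k < K` of the `K`-th torus, let `Y` be a fine region saturated at
level `k+1` (`hY`, dag-n11-e's (0.4)-window hypothesis; at 11a's `genDataOfRecord` `Y = (Ω_{k+1})ᶜ`, a union of blocks) and `sV`, `sV'` finsets
REPRESENTING its level-`k` and level-`(k+1)` bond sets.  Present the fine carrier `GaugeField (F.P K) k (SU N)` by the bond-partition glue `eβ` at `sV` and
the coarse one by `eα` at `sV'` (Mathlib `piEquivPiSubtypeProd`, dag-n11-e p612977).  THEN for every integrable density `ρ` and every displayed inner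
reading `hin` of the presented density along the inner step (outside variables carried, the remaining coarse variables averaged):
`(transportOfRecord F N K k ρ) ∘ eα =ᵐ (V_out, r) ↦ kernelRTOfRecord F N K k sV sV' (y ↦ Fᵢ (y, r)) V_out` — def-T's transport of record READ THROUGH the
presentation is 11a's restricted transport of record on the out-bonds applied to the inner reading, fibrewise in the remaining coarse variables
(FILE 2 §2 with dag-n11-e's five record inputs `fieldMeasure_eq_map_piEquivPiSubtypeProd_symm` ×2, `avOfRecord_glue_eq_glue`,
`map_pi_avgRestrOfRecord_absolutelyContinuous`, `map_prod_avOfRecord_glue_skew_absolutelyContinuous`, def-T's `avOfRecord_haarAC`, and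
`kernelTransport_avgRestrOfRecord_eq_kernelRTOfRecord` = `rfl`). [cite: Balaban1988Convergent, (2.21) p.258, (3.1) p.264 (bookkeeping)] -/
theorem transportOfRecord_comp_glue_ae_eq_kernelRTOfRecord (K k : ℕ) (hkK : k < K)
    [DecidableEq (PBond (F.P K) k)] [DecidableEq (PBond (F.P K) (k + 1))] (hk : k + 1 ≤ (F.P K).m + (F.P K).K)
    {Y : Set (Site (F.P K) 0)} (hY : ∀ s : Site (F.P K) k, toFine k s ∈ Y ↔ toFine (k + 1) (blockOf s) ∈ Y)
    {sV : Finset (PBond (F.P K) k)} (hsV : ∀ b : PBond (F.P K) k, b ∈ sV ↔ b ∈ bondsIn k Y)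
    {sV' : Finset (PBond (F.P K) (k + 1))} (hsV' : ∀ c : PBond (F.P K) (k + 1), c ∈ sV' ↔ c ∈ bondsIn (k + 1) Y)
    {ρ : Density (F.P K) k (SU N)} (hρ : Integrable ρ (fieldMeasure (F.P K) k (SU N)))
    {Fᵢ : (↥sV → SU N) × ({c : PBond (F.P K) (k + 1) // c ∉ sV'} → SU N) → ℝ} (hFm : Measurable Fᵢ)
    (hin : kernelTransport
        ((Measure.pi fun _ : ↥sV => (HaarData.haar : Measure (SU N))).prod
          (Measure.pi fun _ : {b : PBond (F.P K) k // b ∉ sV} => (HaarData.haar : Measure (SU N))))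
        ((Measure.pi fun _ : ↥sV => (HaarData.haar : Measure (SU N))).prod
          (Measure.pi fun _ : {c : PBond (F.P K) (k + 1) // c ∉ sV'} => (HaarData.haar : Measure (SU N))))
        (fun q => (q.1, fun c : {c : PBond (F.P K) (k + 1) // c ∉ sV'} =>
          (avOfRecord F N K k).avg ((MeasurableEquiv.piEquivPiSubtypeProd (fun _ : PBond (F.P K) k => SU N) (· ∈ sV)).symm q) c))
        (ρ ∘ ⇑(MeasurableEquiv.piEquivPiSubtypeProd (fun _ : PBond (F.P K) k => SU N) (· ∈ sV)).symm)
      =ᵐ[(Measure.pi fun _ : ↥sV => (HaarData.haar : Measure (SU N))).prod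
          (Measure.pi fun _ : {c : PBond (F.P K) (k + 1) // c ∉ sV'} => (HaarData.haar : Measure (SU N)))] Fᵢ) :
    (transportOfRecord F N K k ρ) ∘ ⇑(MeasurableEquiv.piEquivPiSubtypeProd (fun _ : PBond (F.P K) (k + 1) => SU N) (· ∈ sV')).symm
      =ᵐ[(Measure.pi fun _ : ↥sV' => (HaarData.haar : Measure (SU N))).prod
          (Measure.pi fun _ : {c : PBond (F.P K) (k + 1) // c ∉ sV'} => (HaarData.haar : Measure (SU N)))]
        fun p => kernelRTOfRecord F N K k sV sV' (fun y => Fᵢ (y, p.2)) p.1 := by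
  have h1 : ∀ b : PBond (F.P K) k, b ∈ bondsIn k Y → b ∈ sV := fun b hb => (hsV b).2 hb
  have h2 : ∀ b : PBond (F.P K) k, b ∈ sV → b ∈ bondsIn k Y := fun b hb => (hsV b).1 hb
  have h3 : ∀ c : PBond (F.P K) (k + 1), c ∈ sV' → c ∈ bondsIn (k + 1) Y := fun c hc => (hsV' c).1 hc
  have h4 : ∀ c : PBond (F.P K) (k + 1), c ∈ bondsIn (k + 1) Y → c ∈ sV' := fun c hc => (hsV' c).2 hc
  have h := kernelTransport_skewProduct_recoord_ae_eq
    (fieldMeasure (F.P K) k (SU N)) (fieldMeasure (F.P K) (k + 1) (SU N))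
    (Measure.pi fun _ : ↥sV => (HaarData.haar : Measure (SU N)))
    (Measure.pi fun _ : {b : PBond (F.P K) k // b ∉ sV} => (HaarData.haar : Measure (SU N)))
    (Measure.pi fun _ : ↥sV' => (HaarData.haar : Measure (SU N)))
    (Measure.pi fun _ : {c : PBond (F.P K) (k + 1) // c ∉ sV'} => (HaarData.haar : Measure (SU N)))
    (MeasurableEquiv.piEquivPiSubtypeProd (fun _ : PBond (F.P K) k => SU N) (· ∈ sV)).symm.measurable
    (fieldMeasure_eq_map_piEquivPiSubtypeProd_symm sV).symm
    (MeasurableEquiv.piEquivPiSubtypeProd (fun _ : PBond (F.P K) (k + 1) => SU N) (· ∈ sV')).symm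
    (fieldMeasure_eq_map_piEquivPiSubtypeProd_symm sV').symm
    (avOfRecord_measurable F N K k) (measurable_avgRestrOfRecord (F := F) (N := N) K k sV sV')
    (measurable_avOfRecord_glue_rest F N K k sV sV')
    (avOfRecord_glue_eq_glue F N K k hk hY h1 h3) (avOfRecord_haarAC F N K k hkK)
    (map_pi_avgRestrOfRecord_absolutelyContinuous F N K k hk hY h1 h3)
    (map_prod_avOfRecord_glue_skew_absolutelyContinuous F N K k hk hY h2 h4) hρ hFm hin
  exact h

/-- ★★★★ The same AT 11a's EXACT BOND SETS `(Set.toFinite (bondsIn k Y)).toFinset` ∕ `(Set.toFinite (bondsIn (k+1) Y)).toFinset` (the choice of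
`genDataOfRecord` at `Y = (Ω_{k+1})ᶜ`): only the saturation `hY` and the inner reading `hin` stay displayed. [cite: Balaban1988Convergent, (2.21) p.258, (3.1) p.264 (bookkeeping)] -/
theorem transportOfRecord_comp_glue_ae_eq_kernelRTOfRecord_bondsIn (K k : ℕ) (hkK : k < K)
    [DecidableEq (PBond (F.P K) k)] [DecidableEq (PBond (F.P K) (k + 1))] (hk : k + 1 ≤ (F.P K).m + (F.P K).K)
    {Y : Set (Site (F.P K) 0)} (hY : ∀ s : Site (F.P K) k, toFine k s ∈ Y ↔ toFine (k + 1) (blockOf s) ∈ Y)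
    {ρ : Density (F.P K) k (SU N)} (hρ : Integrable ρ (fieldMeasure (F.P K) k (SU N)))
    {Fᵢ : (↥(Set.toFinite (bondsIn k Y)).toFinset → SU N) ×
        ({c : PBond (F.P K) (k + 1) // c ∉ (Set.toFinite (bondsIn (k + 1) Y)).toFinset} → SU N) → ℝ} (hFm : Measurable Fᵢ)
    (hin : kernelTransport
        ((Measure.pi fun _ : ↥(Set.toFinite (bondsIn k Y)).toFinset => (HaarData.haar : Measure (SU N))).prod
          (Measure.pi fun _ : {b : PBond (F.P K) k // b ∉ (Set.toFinite (bondsIn k Y)).toFinset} => (HaarData.haar : Measure (SU N))))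
        ((Measure.pi fun _ : ↥(Set.toFinite (bondsIn k Y)).toFinset => (HaarData.haar : Measure (SU N))).prod
          (Measure.pi fun _ : {c : PBond (F.P K) (k + 1) // c ∉ (Set.toFinite (bondsIn (k + 1) Y)).toFinset} =>
            (HaarData.haar : Measure (SU N))))
        (fun q => (q.1, fun c : {c : PBond (F.P K) (k + 1) // c ∉ (Set.toFinite (bondsIn (k + 1) Y)).toFinset} =>
          (avOfRecord F N K k).avg
            ((MeasurableEquiv.piEquivPiSubtypeProd (fun _ : PBond (F.P K) k => SU N)
              (· ∈ (Set.toFinite (bondsIn k Y)).toFinset)).symm q) c))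
        (ρ ∘ ⇑(MeasurableEquiv.piEquivPiSubtypeProd (fun _ : PBond (F.P K) k => SU N)
          (· ∈ (Set.toFinite (bondsIn k Y)).toFinset)).symm)
      =ᵐ[(Measure.pi fun _ : ↥(Set.toFinite (bondsIn k Y)).toFinset => (HaarData.haar : Measure (SU N))).prod
          (Measure.pi fun _ : {c : PBond (F.P K) (k + 1) // c ∉ (Set.toFinite (bondsIn (k + 1) Y)).toFinset} =>
            (HaarData.haar : Measure (SU N)))] Fᵢ) :
    (transportOfRecord F N K k ρ) ∘
        ⇑(MeasurableEquiv.piEquivPiSubtypeProd (fun _ : PBond (F.P K) (k + 1) => SU N)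
          (· ∈ (Set.toFinite (bondsIn (k + 1) Y)).toFinset)).symm
      =ᵐ[(Measure.pi fun _ : ↥(Set.toFinite (bondsIn (k + 1) Y)).toFinset => (HaarData.haar : Measure (SU N))).prod
          (Measure.pi fun _ : {c : PBond (F.P K) (k + 1) // c ∉ (Set.toFinite (bondsIn (k + 1) Y)).toFinset} =>
            (HaarData.haar : Measure (SU N)))]
        fun p => kernelRTOfRecord F N K k (Set.toFinite (bondsIn k Y)).toFinset (Set.toFinite (bondsIn (k + 1) Y)).toFinset
          (fun y => Fᵢ (y, p.2)) p.1 :=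
  transportOfRecord_comp_glue_ae_eq_kernelRTOfRecord F N K k hkK hk hY (fun b => mem_toFinite_bondsIn_toFinset_iff Y b)
    (fun c => mem_toFinite_bondsIn_toFinset_iff Y c) hρ hFm hin

/-- ★★★★ **THE SEPARATED TRANSPORT OF RECORD, INNER FIBRE CHARTED** (§1 at the record): with the data of
`transportOfRecord_comp_glue_ae_eq_kernelRTOfRecord` and, instead of a displayed inner reading, dag-n11-d's ⊗ₘκ SOCKET for the inner step on the
presented carriers — fibre references `κ (y, r)`, inside configuration `Ψ ((y, r), x)` of the bonds off `sV`, Jacobian `J`, charted set `S` (`hpush`, `hfib`)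
— and an integrable measurable density `ρ` whose presented density vanishes off `S`:
`(transportOfRecord F N K k ρ) ∘ eα =ᵐ (V_out, r) ↦ kernelRTOfRecord F N K k sV sV' [y ↦ ∫ J((y,r),x) · ρ (eβ (y, Ψ ((y,r),x))) ∂κ(y,r)] V_out` —
«outside variables by 11a's un-charted restricted transport of record, inside variables of the operand read at the chart point» ([III] (2.21) ∕ (3.23)–(3.25)),
modulo the chart. [cite: Balaban1988Convergent, (2.21) p.258, (3.1) p.264, (3.23)–(3.25) p.270 (bookkeeping)] -/
theorem transportOfRecord_comp_glue_ae_eq_kernelRTOfRecord_of_innerChart (K k : ℕ) (hkK : k < K)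
    [DecidableEq (PBond (F.P K) k)] [DecidableEq (PBond (F.P K) (k + 1))] (hk : k + 1 ≤ (F.P K).m + (F.P K).K)
    {Y : Set (Site (F.P K) 0)} (hY : ∀ s : Site (F.P K) k, toFine k s ∈ Y ↔ toFine (k + 1) (blockOf s) ∈ Y)
    {sV : Finset (PBond (F.P K) k)} (hsV : ∀ b : PBond (F.P K) k, b ∈ sV ↔ b ∈ bondsIn k Y)
    {sV' : Finset (PBond (F.P K) (k + 1))} (hsV' : ∀ c : PBond (F.P K) (k + 1), c ∈ sV' ↔ c ∈ bondsIn (k + 1) Y)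
    {X : Type*} [MeasurableSpace X]
    {κ : Kernel ((↥sV → SU N) × ({c : PBond (F.P K) (k + 1) // c ∉ sV'} → SU N)) X} [IsSFiniteKernel κ]
    {Ψ : ((↥sV → SU N) × ({c : PBond (F.P K) (k + 1) // c ∉ sV'} → SU N)) × X → ({b : PBond (F.P K) k // b ∉ sV} → SU N)}
    (hΨ : Measurable Ψ)
    {J : ((↥sV → SU N) × ({c : PBond (F.P K) (k + 1) // c ∉ sV'} → SU N)) × X → ℝ≥0} (hJ : Measurable J)
    {S : Set ((↥sV → SU N) × ({b : PBond (F.P K) k // b ∉ sV} → SU N))}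
    (hpush : ((((Measure.pi fun _ : ↥sV => (HaarData.haar : Measure (SU N))).prod
          (Measure.pi fun _ : {c : PBond (F.P K) (k + 1) // c ∉ sV'} => (HaarData.haar : Measure (SU N)))) ⊗ₘ κ).withDensity
          (fun z => (J z : ℝ≥0∞))).map (fun z => (z.1.1, Ψ z))
      = ((Measure.pi fun _ : ↥sV => (HaarData.haar : Measure (SU N))).prod
          (Measure.pi fun _ : {b : PBond (F.P K) k // b ∉ sV} => (HaarData.haar : Measure (SU N)))).restrict S)
    (hfib : ∀ᵐ z ∂((((Measure.pi fun _ : ↥sV => (HaarData.haar : Measure (SU N))).prod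
          (Measure.pi fun _ : {c : PBond (F.P K) (k + 1) // c ∉ sV'} => (HaarData.haar : Measure (SU N)))) ⊗ₘ κ).withDensity
          (fun z => (J z : ℝ≥0∞))),
      (fun c : {c : PBond (F.P K) (k + 1) // c ∉ sV'} =>
        (avOfRecord F N K k).avg ((MeasurableEquiv.piEquivPiSubtypeProd (fun _ : PBond (F.P K) k => SU N) (· ∈ sV)).symm
          (z.1.1, Ψ z)) c) = z.1.2)
    {ρ : Density (F.P K) k (SU N)} (hρm : Measurable ρ) (hρ : Integrable ρ (fieldMeasure (F.P K) k (SU N)))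
    (hρS : ∀ q, q ∉ S → ρ ((MeasurableEquiv.piEquivPiSubtypeProd (fun _ : PBond (F.P K) k => SU N) (· ∈ sV)).symm q) = 0) :
    (transportOfRecord F N K k ρ) ∘ ⇑(MeasurableEquiv.piEquivPiSubtypeProd (fun _ : PBond (F.P K) (k + 1) => SU N) (· ∈ sV')).symm
      =ᵐ[(Measure.pi fun _ : ↥sV' => (HaarData.haar : Measure (SU N))).prod
          (Measure.pi fun _ : {c : PBond (F.P K) (k + 1) // c ∉ sV'} => (HaarData.haar : Measure (SU N)))]
        fun v => kernelRTOfRecord F N K k sV sV'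
          (fun y => ∫ x, (J ((y, v.2), x) : ℝ) *
            ρ ((MeasurableEquiv.piEquivPiSubtypeProd (fun _ : PBond (F.P K) k => SU N) (· ∈ sV)).symm (y, Ψ ((y, v.2), x))) ∂(κ (y, v.2)))
          v.1 := by
  have h1 : ∀ b : PBond (F.P K) k, b ∈ bondsIn k Y → b ∈ sV := fun b hb => (hsV b).2 hb
  have h2 : ∀ b : PBond (F.P K) k, b ∈ sV → b ∈ bondsIn k Y := fun b hb => (hsV b).1 hb
  have h3 : ∀ c : PBond (F.P K) (k + 1), c ∈ sV' → c ∈ bondsIn (k + 1) Y := fun c hc => (hsV' c).1 hc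
  have h4 : ∀ c : PBond (F.P K) (k + 1), c ∈ bondsIn (k + 1) Y → c ∈ sV' := fun c hc => (hsV' c).2 hc
  exact kernelTransport_recoord_skew_ae_eq_of_innerChart
    (fieldMeasure (F.P K) k (SU N)) (fieldMeasure (F.P K) (k + 1) (SU N))
    (Measure.pi fun _ : ↥sV => (HaarData.haar : Measure (SU N)))
    (Measure.pi fun _ : {b : PBond (F.P K) k // b ∉ sV} => (HaarData.haar : Measure (SU N)))
    (Measure.pi fun _ : ↥sV' => (HaarData.haar : Measure (SU N)))
    (Measure.pi fun _ : {c : PBond (F.P K) (k + 1) // c ∉ sV'} => (HaarData.haar : Measure (SU N)))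
    (MeasurableEquiv.piEquivPiSubtypeProd (fun _ : PBond (F.P K) k => SU N) (· ∈ sV)).symm.measurable
    (fieldMeasure_eq_map_piEquivPiSubtypeProd_symm sV).symm
    (MeasurableEquiv.piEquivPiSubtypeProd (fun _ : PBond (F.P K) (k + 1) => SU N) (· ∈ sV')).symm
    (fieldMeasure_eq_map_piEquivPiSubtypeProd_symm sV').symm
    (avOfRecord_measurable F N K k) (measurable_avgRestrOfRecord (F := F) (N := N) K k sV sV')
    (measurable_avOfRecord_glue_rest F N K k sV sV')
    (avOfRecord_glue_eq_glue F N K k hk hY h1 h3) (avOfRecord_haarAC F N K k hkK)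
    (map_pi_avgRestrOfRecord_absolutelyContinuous F N K k hk hY h1 h3)
    (map_prod_avOfRecord_glue_skew_absolutelyContinuous F N K k hk hY h2 h4) hΨ hJ hpush hfib hρm hρ hρS

end Record

end Summit.QuantumFields.YangMills.Theorems.BalabanUVNodesN11TransportOfRecordSeparated
end
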